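import Literature.Topology.FourManifolds.MMSWPictureRadialCollarB
import Literature.Topology.FourManifolds.MMSWPictureInnerRadial
import Literature.Topology.FourManifolds.MMSWPictureOuterBand
import Literature.Topology.FourManifolds.FishtailCapEnd
import Mathlib.Analysis.SpecialFunctions.SmoothTransition
import HarnessLib

/-!
# The collars of the model boundary: the concrete radial collar data

Topic `Literature/Topology/FourManifolds`; part of the proof of the named fact
`Literature.Topology.FourManifolds.pictureSurgeryPresentation` (`MMSWPictureSurgery.lean`; Kirby,
*The Topology of 4-Manifolds*, LNM 1374 (1989), Ch. I §2, Lemma 2.1).  Everything here is proved;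
no named fact is introduced.

The abstract radial collar package (`MMSWPictureRadialCollar`, `MMSWPictureRadialCollarB`) is
instantiated for the planar potential `g_k` of the model boundary `M_k`:

* **inner collars**: for each hole `c_j`, the data `(c_j, g_k)` on the annulus
  `1/2 < |z − c_j| < 27/20` satisfy the hypotheses of the package (`inner_smooth`, `inner_pos`,
  `inner_radial` — the last from `exists_hasDerivAt_planarPot_ray`);
* **the outer collar**: in the latitude coordinate `q = Λ_k(z) = s_k(z) · (y_k(z)/|y_k(z)|)`
  (`latCoord`, with explicit inverse `latCoordInv q = Z_k(q/|q|, |q|)` from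
  `MMSWPictureOuterChart`), the potential `ĝ_k = g_k ∘ Λ_k⁻¹` (`outerPot`) on the annulus
  `c_k − 1/50 < |q| < c_k + 1/50` about `0` satisfies them as well (`outer_smooth`, `outer_pos`,
  `outer_radial` — the last from `exists_hasDerivAt_planarPot_outerZ`);
* the **cutoff** `χ_η(g) = smoothTransition ((g − (1 − 3η/2))/(η/2))` of the compressions
  (`cutoff`) with its plateaus and monotonicity.

The identifications `ℂ ↔ ℝ²` are the tree's `toC` (`TorusCoordinates`) and `toE2`
(`FishtailCapEnd`).

## References

* R. Kirby, *The Topology of 4-Manifolds*, LNM 1374 (1989), Ch. I §2. [Kirby1989]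
-/

open scoped Manifold ContDiff Topology Real ComplexConjugate
open Function Set

noncomputable section

namespace Literature.Topology.FourManifolds

/-- Local notation: `𝔼 n` is the model Euclidean space `EuclideanSpace ℝ (Fin n)`. -/
local notation "𝔼 " n:arg => EuclideanSpace ℝ (Fin n)

namespace MMSW

open Literature.AlgebraicTopology.Homotopy.HopfFibration (zC wC)

variable {k : ℕ}

/-! ## The cutoff of the compressions -/

/-- **The cutoff** `χ_η(g) = smoothTransition ((g − (1 − 3η/2))/(η/2))`: `0` for `g ≤ 1 − 3η/2`,
`1` for `g ≥ 1 − η`, smooth and monotone. [folklore] -/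
def cutoff (η g : ℝ) : ℝ := Real.smoothTransition ((g - (1 - 3 * η / 2)) / (η / 2))

variable {η : ℝ}

/-- The cutoff is smooth. [folklore] -/
theorem contDiff_cutoff (η : ℝ) : ContDiff ℝ ∞ (cutoff η) :=
  Real.smoothTransition.contDiff.comp ((contDiff_id.sub contDiff_const).div_const _)

/-- The cutoff is monotone (`η > 0`). [folklore] -/
theorem monotone_cutoff (hη : 0 < η) : Monotone (cutoff η) := fun a b hab ↦
  Real.smoothTransition.monotone (div_le_div_of_nonneg_right (by linarith) (by linarith))

/-- The cutoff has nonnegative derivative (`η > 0`). [folklore] -/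
theorem deriv_cutoff_nonneg (hη : 0 < η) (g : ℝ) : 0 ≤ deriv (cutoff η) g :=
  (monotone_cutoff hη).deriv_nonneg

/-- `0 ≤ χ_η`. [folklore] -/
theorem cutoff_nonneg (η g : ℝ) : 0 ≤ cutoff η g := Real.smoothTransition.nonneg _

/-- `χ_η ≤ 1`. [folklore] -/
theorem cutoff_le_one (η g : ℝ) : cutoff η g ≤ 1 := Real.smoothTransition.le_one _

/-- The lower plateau: `χ_η(g) = 0` for `g ≤ 1 − 3η/2` (`η > 0`). [folklore] -/
theorem cutoff_eq_zero (hη : 0 < η) {g : ℝ} (hg : g ≤ 1 - 3 * η / 2) : cutoff η g = 0 :=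
  Real.smoothTransition.zero_of_nonpos (div_nonpos_of_nonpos_of_nonneg (by linarith) (by linarith))

/-- The upper plateau: `χ_η(g) = 1` for `g ≥ 1 − η` (`η > 0`). [folklore] -/
theorem cutoff_eq_one (hη : 0 < η) {g : ℝ} (hg : 1 - η ≤ g) : cutoff η g = 1 :=
  Real.smoothTransition.one_of_one_le (by rw [le_div_iff₀ (by linarith)]; linarith)

/-- Off the lower plateau the argument exceeds the threshold: `χ_η(g) ≠ 0 → g > 1 − 3η/2`.
[folklore] -/
theorem lt_of_cutoff_ne_zero (hη : 0 < η) {g : ℝ} (h : cutoff η g ≠ 0) : 1 - 3 * η / 2 < g := by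
  by_contra h'
  push Not at h'
  exact h (cutoff_eq_zero hη h')

/-! ## The inner collars -/

/-- Points of the inner annulus about `c_j` are off all the poles. [folklore] -/
theorem ne_holeCentre_of_mem_annulus {j : Fin k} {z : ℂ}
    (hz : z ∈ annulus (holeCentre k j) (1 / 2) (27 / 20)) (i : Fin k) : z ≠ holeCentre k i := by
  by_cases hij : i = j
  · subst hij
    exact ne_centre_of_mem_annulus (by norm_num) hz
  · intro h
    have := norm_sub_holeCentre_ge_of_near hz.2.le hij
    rw [h, sub_self, norm_zero] at this
    linarith

/-- **Inner collar, smoothness**: `g_k` is smooth on the inner annulus about `c_j`. [folklore] -/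
theorem inner_smooth (j : Fin k) :
    ∀ z ∈ annulus (holeCentre k j) (1 / 2) (27 / 20), ContDiffAt ℝ ∞ (planarPot k) z :=
  fun _ hz ↦ contDiffAt_planarPot (ne_holeCentre_of_mem_annulus hz)

/-- **Inner collar, positivity**: `g_k > 0` on the inner annulus (indeed `≥ |z − c_j|⁻² > 0`).
[folklore] -/
theorem inner_pos (j : Fin k) :
    ∀ z ∈ annulus (holeCentre k j) (1 / 2) (27 / 20), 0 < planarPot k z := by
  intro z hz
  have h0 : z ≠ holeCentre k j := ne_centre_of_mem_annulus (by norm_num) hz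
  rw [planarPot_eq_bigRadius]
  have hpos : 0 < 1 / Complex.normSq (z - holeCentre k j) :=
    one_div_pos.2 (Complex.normSq_pos.2 (sub_ne_zero.2 h0))
  have hsum : 1 / Complex.normSq (z - holeCentre k j) ≤
      ∑ i : Fin k, 1 / Complex.normSq (z - holeCentre k i) :=
    Finset.single_le_sum (f := fun i ↦ 1 / Complex.normSq (z - holeCentre k i))
      (fun i _ ↦ one_div_nonneg.2 (Complex.normSq_nonneg _)) (Finset.mem_univ j)
  have h0' : 0 ≤ Complex.normSq z / bigRadius k ^ 2 :=
    div_nonneg (Complex.normSq_nonneg _) (sq_nonneg _)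
  linarith

/-- **Inner collar, radial derivative**: along every ray from `c_j` the potential has negative
derivative on the inner annulus. [folklore] -/
theorem inner_radial (j : Fin k) :
    ∀ v : ℂ, ‖v‖ = 1 → ∀ r, (1 : ℝ) / 2 < r → r < 27 / 20 →
      ∃ d < 0, HasDerivAt (fun r : ℝ ↦ planarPot k (holeCentre k j + (r : ℂ) * v)) d r := by
  intro v hv r hr1 hr2
  obtain ⟨d, hd, hdneg⟩ := exists_hasDerivAt_planarPot_ray j hv (by linarith) hr2.le
  refine ⟨d, hdneg, ?_⟩
  have hfun : (fun r : ℝ ↦ planarPot k (holeCentre k j + (r : ℂ) * v)) =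
      fun r : ℝ ↦ planarPot k (holeCentre k j + r • v) := by
    funext r; rw [Complex.real_smul]
  rw [hfun]
  exact hd

/-! ## The latitude coordinate and its inverse

We use the tree's identifications `toC : ℝ² → ℂ` (`TorusCoordinates`) and `toE2 : ℂ → ℝ²`
(`FishtailCapEnd`). -/

/-- **The latitude coordinate** `Λ_k(z) = s_k(z) · (y_k(z)/|y_k(z)|)` of a planar point: polar
radius the latitude, polar direction the direction of the co-latitude vector. [folklore] -/
def latCoord (k : ℕ) (z : ℂ) : ℂ := ((latS k z : ℝ) : ℂ) * toC (coLatDir k z)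

/-- **The inverse latitude coordinate** `Λ_k⁻¹(q) = Z_k(q/|q|, |q|)`. [folklore] -/
def latCoordInv (k : ℕ) (q : ℂ) : ℂ := outerZ k (toE2 (unitDir 0 q)) ‖q‖

variable {z q : ℂ}

/-- `|Λ_k(z)| = s_k(z)` off the focus (`s ≥ 0`). [folklore] -/
theorem norm_latCoord (hz : coLat k z ≠ 0) (hs : 0 ≤ latS k z) : ‖latCoord k z‖ = latS k z := by
  rw [latCoord, norm_mul, Complex.norm_real, Real.norm_of_nonneg hs, norm_toC, norm_coLatDir hz,
    mul_one]

/-- The direction of `Λ_k(z)` is `y/|y|` off the focus (`s > 0`). [folklore] -/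
theorem unitDir_latCoord (hz : coLat k z ≠ 0) (hs : 0 < latS k z) :
    unitDir 0 (latCoord k z) = toC (coLatDir k z) := by
  have h : latCoord k z = 0 + ((latS k z : ℝ) : ℂ) * toC (coLatDir k z) := by rw [latCoord, zero_add]
  rw [h, unitDir_ray (by rw [norm_toC, norm_coLatDir hz]) hs]

/-- **`Λ⁻¹ ∘ Λ = id`** off the focus (`s > 0`). [folklore] -/
theorem latCoordInv_latCoord (hz : coLat k z ≠ 0) (hs : 0 < latS k z) :
    latCoordInv k (latCoord k z) = z := by
  rw [latCoordInv, unitDir_latCoord hz hs, toE2_toC, norm_latCoord hz hs.le, outerZ_coLatDir_latS]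

/-- **`Λ ∘ Λ⁻¹ = id`** on the punctured unit disc. [folklore] -/
theorem latCoord_latCoordInv (hq : q ≠ 0) (hq1 : ‖q‖ < 1) : latCoord k (latCoordInv k q) = q := by
  have hn : 0 < ‖q‖ := norm_pos_iff.2 hq
  have he : ‖toE2 (unitDir 0 q)‖ = 1 := by rw [norm_toE2, norm_unitDir hq]
  rw [latCoord, latCoordInv, latS_outerZ he hn hq1.le, coLatDir_outerZ he hn hq1, toC_toE2]
  have := norm_mul_unitDir 0 q
  simp only [sub_zero] at this
  exact this

/-- `Λ_k` is smooth off the focus. [folklore] -/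
theorem contDiffAt_latCoord (hz : coLat k z ≠ 0) : ContDiffAt ℝ ∞ (latCoord k) z := by
  have hre : ContDiff ℝ ∞ fun z : ℂ ↦ z.re := Complex.reCLM.contDiff
  have him : ContDiff ℝ ∞ fun z : ℂ ↦ z.im := Complex.imCLM.contDiff
  have hden : ContDiff ℝ ∞ (outerDen k) := by
    unfold outerDen; exact ((hre.add contDiff_const).pow 2 |>.add (him.pow 2)).add contDiff_const
  have hden0 : ∀ z, outerDen k z ≠ 0 := fun z ↦ (outerDen_pos z).ne'
  have hlat : ContDiff ℝ ∞ (latS k) := by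
    unfold latS; exact (contDiff_const.mul (hre.add contDiff_const)).div hden hden0
  have hco : ContDiff ℝ ∞ (coLat k) := by
    rw [contDiff_euclidean]
    intro i
    fin_cases i
    · exact (contDiff_const.mul him).div hden hden0
    · exact (((hre.add contDiff_const).pow 2 |>.add (him.pow 2)).sub contDiff_const).div hden hden0
  have hdir : ContDiffAt ℝ ∞ (coLatDir k) z := by
    unfold coLatDir
    exact ((hco.contDiffAt.norm ℝ hz).inv (norm_ne_zero_iff.2 hz)).smul hco.contDiffAt
  unfold latCoord
  exact (Complex.ofRealCLM.contDiff.comp_contDiffAt z hlat.contDiffAt).mul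
    (contDiff_toC.contDiffAt.comp z hdir)

/-- `Λ_k⁻¹` is smooth on the punctured unit disc. [folklore] -/
theorem contDiffAt_latCoordInv (hq : q ≠ 0) (hq1 : ‖q‖ < 1) : ContDiffAt ℝ ∞ (latCoordInv k) q := by
  have hn : 0 < ‖q‖ := norm_pos_iff.2 hq
  have h1 : ContDiffAt ℝ ∞ (fun q : ℂ ↦ (toE2 (unitDir 0 q), ‖q‖)) q :=
    (contDiff_toE2.contDiffAt.comp q (contDiffAt_unitDir hq)).prodMk (contDiffAt_norm ℝ hq)
  have h2 : ContDiffAt ℝ ∞ (fun p : 𝔼 2 × ℝ ↦ outerZ k p.1 p.2) (toE2 (unitDir 0 q), ‖q‖) :=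
    contDiffAt_outerZ (by simp only; rw [norm_toE2, norm_unitDir hq]) hn hq1
  exact h2.comp q h1

/-! ## The outer collar -/

/-- **The outer potential** `ĝ_k = g_k ∘ Λ_k⁻¹` in the latitude coordinate. [folklore] -/
def outerPot (k : ℕ) (q : ℂ) : ℝ := planarPot k (latCoordInv k q)

/-- `ĝ_k ∘ Λ_k = g_k` off the focus (`s > 0`). [folklore] -/
theorem outerPot_latCoord (hz : coLat k z ≠ 0) (hs : 0 < latS k z) :
    outerPot k (latCoord k z) = planarPot k z := by
  rw [outerPot, latCoordInv_latCoord hz hs]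

/-- The outer annulus radii: `c_k − 1/50 ≥ 1/2` and the annulus lies in the punctured unit disc.
[folklore] -/
theorem outer_annulus_bounds (hq : q ∈ annulus 0 (latC k - 1 / 50) (latC k + 1 / 50)) :
    q ≠ 0 ∧ 0 < ‖q‖ ∧ ‖q‖ < 1 ∧ ‖q‖ ∈ outerBand k := by
  obtain ⟨h1, h2⟩ := hq
  rw [sub_zero] at h1 h2
  have hc1 := lt_latC (k := k)
  have hc2 := latC_lt (k := k)
  have hpos : 0 < ‖q‖ := by linarith
  exact ⟨norm_pos_iff.1 hpos, hpos, by linarith, ⟨h1.le, h2.le⟩⟩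

/-- `c_k − 1/50 ≥ 1/2`. [folklore] -/
theorem half_le_outer_a₁ : (1 : ℝ) / 2 ≤ latC k - 1 / 50 := by
  have := lt_latC (k := k); linarith

/-- **Outer collar, smoothness**: `ĝ_k` is smooth on the outer annulus. [folklore] -/
theorem outer_smooth :
    ∀ q ∈ annulus 0 (latC k - 1 / 50) (latC k + 1 / 50), ContDiffAt ℝ ∞ (outerPot k) q := by
  intro q hq
  obtain ⟨hq0, -, hq1, hband⟩ := outer_annulus_bounds hq
  have he : ‖toE2 (unitDir 0 q)‖ = 1 := by rw [norm_toE2, norm_unitDir hq0]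
  have hfar : ∀ j : Fin k, latCoordInv k q ≠ holeCentre k j := fun j h ↦ by
    have := norm_outerZ_sub_holeCentre_ge he hband j
    rw [latCoordInv] at h
    rw [h, sub_self, norm_zero] at this
    have hk : (0 : ℝ) < 25 * ((k : ℝ) + 1) := by positivity
    linarith
  exact (contDiffAt_planarPot hfar).comp q (contDiffAt_latCoordInv hq0 hq1)

/-- **Outer collar, positivity**: `ĝ_k > 0` on the outer annulus. [folklore] -/
theorem outer_pos : ∀ q ∈ annulus 0 (latC k - 1 / 50) (latC k + 1 / 50), 0 < outerPot k q := by
  intro q hq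
  obtain ⟨hq0, -, -, hband⟩ := outer_annulus_bounds hq
  have he : ‖toE2 (unitDir 0 q)‖ = 1 := by rw [norm_toE2, norm_unitDir hq0]
  have hZ := le_norm_outerZ he hband
  rw [outerPot, latCoordInv, planarPot_eq_bigRadius]
  have hsum : 0 ≤ ∑ j : Fin k, 1 / Complex.normSq (outerZ k (toE2 (unitDir 0 q)) ‖q‖ - holeCentre k j) :=
    Finset.sum_nonneg fun j _ ↦ one_div_nonneg.2 (Complex.normSq_nonneg _)
  have hR := bigRadius_pos (k := k)
  have hnorm : 0 < Complex.normSq (outerZ k (toE2 (unitDir 0 q)) ‖q‖) := by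
    rw [Complex.normSq_eq_norm_sq]
    have hk : (0 : ℝ) < 29 * ((k : ℝ) + 1) := by positivity
    nlinarith
  have : 0 < Complex.normSq (outerZ k (toE2 (unitDir 0 q)) ‖q‖) / bigRadius k ^ 2 := by positivity
  linarith

/-- **Outer collar, radial derivative**: along every ray from `0` the outer potential has negative
derivative on the outer annulus (indeed `≤ −2`). [folklore] -/
theorem outer_radial :
    ∀ v : ℂ, ‖v‖ = 1 → ∀ r, latC k - 1 / 50 < r → r < latC k + 1 / 50 →
      ∃ d < 0, HasDerivAt (fun r : ℝ ↦ outerPot k (0 + (r : ℂ) * v)) d r := by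
  intro v hv r hr1 hr2
  have hr0 : 0 < r := by linarith [lt_latC (k := k)]
  have he : ‖toE2 v‖ = 1 := by rw [norm_toE2, hv]
  obtain ⟨d, hd, hdle⟩ := exists_hasDerivAt_planarPot_outerZ he (s := r) ⟨hr1.le, hr2.le⟩
  refine ⟨d, by linarith, ?_⟩
  -- the two functions agree near `r` (`r > 0`)
  have heq : (fun s : ℝ ↦ planarPot k (outerZ k (toE2 v) s)) =ᶠ[𝓝 r]
      fun s : ℝ ↦ outerPot k (0 + (s : ℂ) * v) := by
    filter_upwards [Ioi_mem_nhds hr0] with s hs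
    rw [outerPot, latCoordInv, unitDir_ray hv hs, zero_add, norm_mul, Complex.norm_real, hv, mul_one,
      Real.norm_of_nonneg (le_of_lt hs)]
  exact hd.congr_of_eventuallyEq heq.symm

end MMSW

end Literature.Topology.FourManifolds
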